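import Summits.ResolutionOfSingularities.ResolutionOfSingularities.Theorems.FrobeniusLadderFInjectiveMacaulayficationFedderClosure
import Summits.ResolutionOfSingularities.ResolutionOfSingularities.Theorems.FrobeniusLadderFInjectiveMacaulayficationCIChartCore
import HarnessLib

/-!
# Fedder's criterion beyond hypersurfaces, sufficiency, in Frobenius-closure form (no F-finiteness):
# ideals with a Fedder element, and complete intersections

Support file for crux stmt-ResolutionOfSingularities-15315 (`FrobeniusLadder.FInjectiveMacaulayfication`),
chain w45a, seat res-L1-w45a-stub-6 (res-D-pv-018, D→L convert), file 3 of the CI-CN engine kernel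
(res-L1-w45a-plan-1 R8.4). [OURS · L1 W4.5a] — NOT a statement of the manuscript [claim: Hironaka2017];
AI-written, weaker than expert review.

`…FedderClosure.lean` (certification engine E2) proves: in a regular local ring `(R, 𝔪)` of prime
characteristic `p`, if `f^(p-1) ∉ 𝔪^[p]` then every ideal of `R/(f)` is Frobenius closed (Kunz's flat colon
`I^[p] : y^p ⊆ (I : y)^[p]`, `mem_frobeniusPower_colon_of_isRegularLocalRing`), and every system of parameters of
`R/(f)` is weakly regular. The same route works for ANY ideal `I₀` once a **Fedder element** is given: some
`u ∉ 𝔪^[p]` with `u·I₀ ⊆ I₀^[p]`, i.e. `u ∈ (I₀^[p] : I₀) ∖ 𝔪^[p]` — the hypothesis of Fedder's criterion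
[Fedder1983, Prop. 1.7 / Thm. 1.12] for an arbitrary ideal. For a COMPLETE INTERSECTION `I₀ = (g₁, …, g_c)`
the element `u = (∏ gᵢ)^(p-1)` is such: `u·gⱼ = gⱼ^p·∏_(i≠j) gᵢ^(p-1) ∈ (gⱼ^p) ⊆ I₀^[p]` — no regular-sequence
hypothesis is needed for this inclusion [Fedder1983, Prop. 2.1].

* §1 `mem_sup_of_pow_mem_of_colon` (the `p`-step), `mem_sup_of_pow_pow_mem_of_colon` (the `p^e`-step),
  `frobeniusClosed_quotient_of_colon` — every ideal of `R ⧸ I₀` is Frobenius closed (inline form of the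
  crux's clause), for `I₀` with a Fedder element; `fedder_clause_of_colon` (binders explicit).
* §2 `prod_pow_mul_mem_frobeniusPower` — `(∏ gs)^(p-1)·g ∈ (gs)^[p]` for `g ∈ (gs)`.
* §3 `fedder_ci_clause` — **Fedder for complete intersections, sufficiency, closure form**: `gs ⊆ 𝔪` a finite
  list with `(∏ gs)^(p-1) ∉ 𝔪^[p]` and `dim R⧸(gs) + |gs| = dim R`; then `R ⧸ (gs)` has every ideal Frobenius
  closed and every system of parameters weakly regular (the Cohen–Macaulay half is
  `CIChartCore.sop_isWeaklyRegular_quotient_ofList`) — i.e. it satisfies the per-stalk clause of the crux. This is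
  the «CI Fedder chart theorem» that feeds the hypothesis of `CIChartCore.ciChartCore` (CRUX-PLAN v7/v8 §2,
  CI-CN_{κ=1}).

NOT claimed: the necessity direction for complete intersections (`(I^[p] : I) = (F^(p-1)) + I^[p]` for a
regular sequence, [Fedder1983, Prop. 2.1]). No definitions, no named facts; glue. [folklore]
-/

-- single-problem summit: the doubled namespace component is forced
set_option linter.dupNamespace false

namespace Summit.ResolutionOfSingularities.ResolutionOfSingularities.Theorems.FInjectiveMacaulayfication.CIFedder

open IsLocalRing RingTheory.Sequence Literature.RingTheory.TightClosure
  Literature.AlgebraicGeometry.Resolution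
  Summit.ResolutionOfSingularities.ResolutionOfSingularities.Theorems.FInjectiveMacaulayfication

variable {R : Type*} [CommRing R]

/-! ## §1 An ideal with a Fedder element: `J + I₀` is closed under `p`-th roots modulo `J^[p]` -/

section Closure

variable (p : ℕ) [Fact p.Prime] [CharP R p] [IsRegularLocalRing R]

/-- **The `p`-step.** In a regular local ring `(R, 𝔪)` of characteristic `p`, let `I₀` be an ideal with a
Fedder element `u`: `u ∉ 𝔪^[p]` and `u·g ∈ I₀^[p]` for all `g ∈ I₀`. Then for every ideal `J`:
`y^p ∈ J^[p] + I₀` implies `y ∈ J + I₀`. Proof: with `I = J + I₀`, `u y^p ∈ J^[p] + I₀^[p] ⊆ I^[p]`, so by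
Kunz `u ∈ (I : y)^[p]`; if `y ∉ I` then `(I : y) ⊆ 𝔪` and `u ∈ 𝔪^[p]`.
[cite: Fedder1983, Prop. 1.7 and proof of Thm. 1.12] -/
-- adapted from `Fedder.mem_sup_span_of_pow_mem` (the hypersurface case `I₀ = (f)`, `u = f^(p-1)`)
theorem mem_sup_of_pow_mem_of_colon {I₀ : Ideal R} {u : R}
    (hu : u ∉ frobeniusPower p (maximalIdeal R)) (hcol : ∀ g ∈ I₀, u * g ∈ frobeniusPower p I₀)
    (J : Ideal R) {y : R} (hy : y ^ p ∈ frobeniusPower p J ⊔ I₀) : y ∈ J ⊔ I₀ := by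
  set I : Ideal R := J ⊔ I₀ with hI
  by_contra hyI
  obtain ⟨j, hj, g, hg, hjg⟩ := Submodule.mem_sup.mp hy
  -- `u y^p ∈ I^[p]`
  have h1 : u * y ^ p ∈ frobeniusPower p I := by
    rw [← hjg, mul_add]
    exact add_mem (Ideal.mul_mem_left _ _ (frobeniusPower_mono p le_sup_left hj))
      (frobeniusPower_mono p le_sup_right (hcol g hg))
  -- Kunz: `u ∈ (I : y)^[p]`
  have h3 : u ∈ frobeniusPower p (I.colon {y}) := by
    have h := mem_frobeniusPower_colon_of_isRegularLocalRing p (I := I) (x := y) (c := u) 1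
      (by simpa only [pow_one] using h1)
    simpa only [pow_one] using h
  have hne : I.colon {y} ≠ ⊤ := by
    intro htop
    have h1' : (1 : R) ∈ I.colon {y} := htop ▸ Submodule.mem_top
    rw [Submodule.mem_colon_singleton, one_smul] at h1'
    exact hyI h1'
  exact hu (frobeniusPower_mono p (le_maximalIdeal hne) h3)

/-- **The `p^e`-step** (induction on `e`, applying `mem_sup_of_pow_mem_of_colon` to `J^[p^e]`): with a Fedder
element for `I₀`, `y^(p^e) ∈ J^[p^e] + I₀` implies `y ∈ J + I₀`.
[cite: Fedder1983, Prop. 1.7 and proof of Thm. 1.12] -/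
-- adapted from `Fedder.mem_sup_span_of_pow_pow_mem`
theorem mem_sup_of_pow_pow_mem_of_colon {I₀ : Ideal R} {u : R}
    (hu : u ∉ frobeniusPower p (maximalIdeal R)) (hcol : ∀ g ∈ I₀, u * g ∈ frobeniusPower p I₀) :
    ∀ (e : ℕ) (J : Ideal R) {y : R},
      y ^ p ^ e ∈ frobeniusPower (p ^ e) J ⊔ I₀ → y ∈ J ⊔ I₀ := by
  intro e
  induction e with
  | zero =>
    intro J y hy
    simpa only [pow_zero, pow_one, frobeniusPower_one] using hy
  | succ e ih =>
    intro J y hy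
    refine ih J (mem_sup_of_pow_mem_of_colon p hu hcol (frobeniusPower (p ^ e) J) ?_)
    have h1 : frobeniusPower p (frobeniusPower (p ^ e) J) = frobeniusPower (p ^ (e + 1)) J := by
      simpa only [pow_one] using frobeniusPower_frobeniusPower p e 1 J
    rw [← pow_mul, ← pow_succ, h1]
    exact hy

/-- **Every ideal of `R ⧸ I₀` is Frobenius closed** when `(R, 𝔪)` is regular local of characteristic `p` and
`I₀` has a Fedder element `u ∈ (I₀^[p] : I₀) ∖ 𝔪^[p]` — inline form of route `FrobeniusLadder`
(`y^(p^e) ∈ span {z^(p^e) | z ∈ I} ⇒ y ∈ I`). Lift to `R`: with `J` the preimage of `I`, a lift `y₀` of `y`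
has `y₀^(p^e) ∈ J^[p^e] + I₀`, so `y₀ ∈ J + I₀ = J`. [cite: Fedder1983, Prop. 1.7, Thm. 1.12] -/
-- adapted from `Fedder.frobeniusClosed_quotient`
theorem frobeniusClosed_quotient_of_colon {I₀ : Ideal R} {u : R}
    (hu : u ∉ frobeniusPower p (maximalIdeal R)) (hcol : ∀ g ∈ I₀, u * g ∈ frobeniusPower p I₀)
    (I : Ideal (R ⧸ I₀)) (y : R ⧸ I₀)
    (hy : ∃ e : ℕ, y ^ p ^ e ∈ Ideal.span ((fun z : R ⧸ I₀ => z ^ p ^ e) '' (I : Set (R ⧸ I₀)))) :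
    y ∈ I := by
  obtain ⟨e, he⟩ := hy
  set mk := Ideal.Quotient.mk I₀ with hmk
  obtain ⟨y₀, rfl⟩ := Ideal.Quotient.mk_surjective y
  set J : Ideal R := I.comap mk with hJ
  -- the span of `p^e`-th powers of `I` lies in the image of `J^[p^e]`
  have hspan : Ideal.span ((fun z : R ⧸ I₀ => z ^ p ^ e) '' (I : Set (R ⧸ I₀)))
      ≤ (frobeniusPower (p ^ e) J).map mk := by
    rw [Ideal.span_le]
    rintro _ ⟨z, hz, rfl⟩
    obtain ⟨z₀, rfl⟩ := Ideal.Quotient.mk_surjective z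
    have hz₀ : z₀ ∈ J := Ideal.mem_comap.mpr hz
    change mk z₀ ^ p ^ e ∈ (frobeniusPower (p ^ e) J).map mk
    rw [← map_pow]
    exact Ideal.mem_map_of_mem mk (pow_mem_frobeniusPower hz₀)
  -- pull back to `R`: `y₀^(p^e) ∈ J^[p^e] + I₀`
  have h1 : y₀ ^ p ^ e ∈ frobeniusPower (p ^ e) J ⊔ I₀ := by
    have h2 : y₀ ^ p ^ e ∈ ((frobeniusPower (p ^ e) J).map mk).comap mk := by
      rw [Ideal.mem_comap, map_pow]
      exact hspan he
    rwa [Ideal.comap_map_of_surjective mk Ideal.Quotient.mk_surjective, ← RingHom.ker_eq_comap_bot,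
      Ideal.mk_ker] at h2
  have h3 : y₀ ∈ J ⊔ I₀ := mem_sup_of_pow_pow_mem_of_colon p hu hcol e J h1
  -- `I₀ ≤ J`, so `J + I₀ = J`
  have hI₀J : I₀ ≤ J := by
    intro g hg
    rw [hJ, Ideal.mem_comap, hmk, Ideal.Quotient.eq_zero_iff_mem.mpr hg]
    exact I.zero_mem
  rw [sup_eq_left.mpr hI₀J] at h3
  exact Ideal.mem_comap.mp h3

end Closure

/-- **Fedder's criterion, sufficiency, Frobenius-closed half, for an ideal with a Fedder element** (all
binders explicit): `R` regular local of prime characteristic `p`, `I₀` an ideal, `u ∉ 𝔪^[p]` with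
`u·I₀ ⊆ I₀^[p]`; then every ideal of `R ⧸ I₀` is Frobenius closed (inline form of the crux's clause). The
form a carrier of any embedding codimension (e.g. a graded domain `k[X]⧸I`) cites for the Frobenius-closed
half; the Cohen–Macaulay half is separate. [cite: Fedder1983, Prop. 1.7 and Thm. 1.12] -/
theorem fedder_clause_of_colon : ∀ (p : ℕ) [Fact p.Prime] (R : Type) [CommRing R] [IsRegularLocalRing R]
    [CharP R p] (I₀ : Ideal R) (u : R), u ∉ frobeniusPower p (IsLocalRing.maximalIdeal R) →
    (∀ g ∈ I₀, u * g ∈ frobeniusPower p I₀) →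
    ∀ (I : Ideal (R ⧸ I₀)) (y : R ⧸ I₀),
      (∃ e : ℕ, y ^ p ^ e ∈ Ideal.span ((fun z : R ⧸ I₀ => z ^ p ^ e) '' (I : Set (R ⧸ I₀)))) → y ∈ I := by
  intro p _ R _ _ _ I₀ u hu hcol I y hy
  exact frobeniusClosed_quotient_of_colon p hu hcol I y hy

/-! ## §2 Complete intersections have the Fedder element `(∏ gᵢ)^(p-1)` -/

/-- For a finite list `gs` and `g` in the ideal `(gs)`: `(∏ gs)^(p-1)·g ∈ (gs)^[p]`. Indeed for a member
`gᵢ` of the list, `gᵢ ∣ ∏ gs`, so `(∏ gs)^(p-1)·gᵢ = gᵢ^p·r^(p-1) ∈ (gᵢ^p)`; the general `g` follows by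
linearity (`(gs) ≤ ((gs)^[p] : (∏ gs)^(p-1))`). [cite: Fedder1983, Prop. 2.1] -/
theorem prod_pow_mul_mem_frobeniusPower (p : ℕ) [Fact p.Prime] (gs : List R) :
    ∀ g ∈ Ideal.ofList gs, gs.prod ^ (p - 1) * g ∈ frobeniusPower p (Ideal.ofList gs) := by
  have hp1 : p - 1 + 1 = p := Nat.sub_add_cancel (Fact.out : p.Prime).one_lt.le
  -- the set of `g` with `(∏ gs)^(p-1)·g ∈ (gs)^[p]` is the ideal `((gs)^[p] : (∏ gs)^(p-1))`
  suffices h : Ideal.ofList gs ≤ (frobeniusPower p (Ideal.ofList gs)).colon {gs.prod ^ (p - 1)} by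
    intro g hg
    have h1 := h hg
    rw [Submodule.mem_colon_singleton, smul_eq_mul] at h1
    rwa [mul_comm] at h1
  refine Ideal.span_le.mpr fun g hg => ?_
  rw [SetLike.mem_coe, Submodule.mem_colon_singleton, smul_eq_mul]
  -- `g ∣ ∏ gs`
  obtain ⟨r, hr⟩ := List.dvd_prod hg
  have hgI : g ∈ Ideal.ofList gs := Ideal.subset_span hg
  have hgp : g ^ p = g ^ (p - 1) * g := by
    rw [← pow_succ, hp1]
  have e1 : gs.prod ^ (p - 1) * g = g ^ p * r ^ (p - 1) := by
    rw [hr, mul_pow, hgp]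
    ring
  rw [mul_comm, e1]
  exact Ideal.mul_mem_right _ _ (pow_mem_frobeniusPower hgI)

/-! ## §3 Fedder for complete intersections (sufficiency, closure form) -/

/-- **FEDDER'S CRITERION FOR COMPLETE INTERSECTIONS, sufficiency, closure form** (the «CI Fedder chart
theorem» of the CI-CN engine): for a regular local ring `(R, 𝔪)` of prime characteristic `p` and a finite list
`gs ⊆ 𝔪` with `(∏ gs)^(p-1) ∉ 𝔪^[p]` and `dim R⧸(gs) + |gs| = dim R` (expected codimension), the quotient
`R ⧸ (gs)` has every ideal Frobenius closed (inline form; this half needs no dimension hypothesis) and every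
system of parameters weakly regular (`CIChartCore.sop_isWeaklyRegular_quotient_ofList`) — i.e. it satisfies the
per-stalk clause of crux `FInjectiveMacaulayfication` (Cohen–Macaulay + F-injective), with no F-finiteness
hypothesis on `R`. [cite: Fedder1983, Prop. 1.7, Thm. 1.12 and Prop. 2.1] -/
theorem fedder_ci_clause : ∀ (p : ℕ) [Fact p.Prime] (R : Type) [CommRing R] [IsRegularLocalRing R]
    [CharP R p] (gs : List R), (∀ g ∈ gs, g ∈ IsLocalRing.maximalIdeal R) →
    gs.prod ^ (p - 1) ∉ frobeniusPower p (IsLocalRing.maximalIdeal R) →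
    ringKrullDim (R ⧸ Ideal.ofList gs) + (gs.length : WithBot ℕ∞) = ringKrullDim R →
    (∀ (I : Ideal (R ⧸ Ideal.ofList gs)) (y : R ⧸ Ideal.ofList gs),
      (∃ e : ℕ, y ^ p ^ e ∈ Ideal.span ((fun z : R ⧸ Ideal.ofList gs => z ^ p ^ e) ''
        (I : Set (R ⧸ Ideal.ofList gs)))) → y ∈ I) ∧
    ∀ d : ℕ, ringKrullDim (R ⧸ Ideal.ofList gs) = d → ∀ s : Fin d → R ⧸ Ideal.ofList gs,
      (Ideal.span (Set.range s)).radical.IsMaximal →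
      RingTheory.Sequence.IsWeaklyRegular (R ⧸ Ideal.ofList gs) (List.ofFn s) := by
  intro p _ R _ _ _ gs hgs hu hdim
  refine ⟨fun I y hy => frobeniusClosed_quotient_of_colon p hu
    (prod_pow_mul_mem_frobeniusPower p gs) I y hy, ?_⟩
  -- the Cohen–Macaulay half: `dim R⧸(gs) = e`, `dim R = |gs| + e`
  obtain ⟨-, hnt, hloc⟩ := CIChartCore.isLocalRing_quotient_ofList gs hgs
  obtain ⟨e, he⟩ := exists_nat_cast_eq_ringKrullDim (R := R ⧸ Ideal.ofList gs)
  have hdimR : ringKrullDim R = ((gs.length + e : ℕ) : WithBot ℕ∞) := by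
    rw [← hdim, he]
    push_cast
    ring
  exact CIChartCore.sop_isWeaklyRegular_quotient_ofList gs hgs e hdimR he

/-- **Corollary: the clause for a complete intersection, packaged as in `ciChartCore`'s hypothesis** — for
lists `gs`, `ys ⊆ 𝔪` of a regular local ring of characteristic `p` with `dim R⧸(gs ++ ys) + |gs| + |ys| = dim R`
and `(∏ (gs ++ ys))^(p-1) ∉ 𝔪^[p]` (the initial complete intersection is F-pure in Fedder's sense), the local
ring `R ⧸ (gs)` of the model satisfies the per-stalk clause of the crux (`fedder_ci_clause` for `gs ++ ys`,
then `CIChartCore.ciChartCore'`). [cite: Fedder1983, Prop. 2.1] -/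
theorem ci_clause_of_fedder_initial : ∀ (p : ℕ) [Fact p.Prime] (R : Type) [CommRing R]
    [IsRegularLocalRing R] [CharP R p] (gs ys : List R), (∀ g ∈ gs, g ∈ IsLocalRing.maximalIdeal R) →
    (∀ y ∈ ys, y ∈ IsLocalRing.maximalIdeal R) →
    ringKrullDim (R ⧸ Ideal.ofList (gs ++ ys)) + ((gs.length + ys.length : ℕ) : WithBot ℕ∞) =
      ringKrullDim R →
    (gs ++ ys).prod ^ (p - 1) ∉ frobeniusPower p (IsLocalRing.maximalIdeal R) →
    ∀ d : ℕ, ringKrullDim (R ⧸ Ideal.ofList gs) = d → ∀ s : Fin d → R ⧸ Ideal.ofList gs,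
      (Ideal.span (Set.range s)).radical.IsMaximal →
      RingTheory.Sequence.IsWeaklyRegular (R ⧸ Ideal.ofList gs) (List.ofFn s) ∧
      ∀ y : R ⧸ Ideal.ofList gs, (∃ e : ℕ, y ^ p ^ e ∈
        Ideal.span ((fun z : R ⧸ Ideal.ofList gs => z ^ p ^ e) ''
          (Ideal.span (Set.range s) : Set (R ⧸ Ideal.ofList gs)))) → y ∈ Ideal.span (Set.range s) := by
  intro p _ R _ _ _ gs ys hgs hys hdim hu
  have hL : ∀ x ∈ gs ++ ys, x ∈ maximalIdeal R := by
    intro x hx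
    rcases List.mem_append.mp hx with hx | hx
    · exact hgs x hx
    · exact hys x hx
  have hdim' : ringKrullDim (R ⧸ Ideal.ofList (gs ++ ys)) + ((gs ++ ys).length : WithBot ℕ∞) =
      ringKrullDim R := by
    rw [List.length_append]; exact hdim
  obtain ⟨hF, hW⟩ := fedder_ci_clause p R (gs ++ ys) hL hu hdim'
  exact CIChartCore.ciChartCore' p R gs ys hgs hys hdim
    (fun d hd s hs => ⟨hW d hd s hs, fun y hy => hF _ y hy⟩)

end Summit.ResolutionOfSingularities.ResolutionOfSingularities.Theorems.FInjectiveMacaulayfication.CIFedder
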